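import Summits.Ventures.LatticeQCDFlow.Scoring.FreeFieldHeatBath
import Mathlib.LinearAlgebra.Matrix.NonsingularInverse
import HarnessLib

/-!
# The ordered heat-bath sweep of the free field is Gauss–Seidel with noise; every matrix-splitting sampler fixes the Gaussian law

HONEST FRAMING: exact (Metropolis-corrected) sampling algorithms for lattice gauge theory;
figures of merit are autocorrelation/cost numbers at stated couplings and volumes; no
continuum-physics claim.  (SCALAR calibration rung S0-A: not a gauge result.)

Venture `LatticeQCDFlow` (cell pub-lqcd), sub-topic `Scoring`; FANOUT row 2 (`s0-phi4`).  NEW WORK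
of the cell (finite sums and matrix algebra over Mathlib); nothing is cited as a fact.  Printed
counterparts, named only: Adler 1981 (over-relaxation = stochastic SOR), Goodman–Sokal 1989
(Phys. Rev. D 40, 2035: "the heat-bath algorithm [for a Gaussian] is stochastic Gauss–Seidel"),
Amit–Grenander 1991 and Roberts–Sahu 1997 (Gibbs sweeps on Gaussians as linear iterations),
Fox–Parker 2017 (Bernoulli 23, matrix splittings `A = M − N` ⇄ generalised Gibbs samplers;
Table 2), Kazashi–Müller–Scheichl 2024 (arXiv:2407.12149, Alg. 2 eq. (3.3)
`θ' = θ + M⁻¹(f + ξ − Aθ)`, `ξ ∼ N(0, M + Mᵀ − A)`; eq. (3.7) the SOR splitting `M = ω⁻¹D + L`).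

`Scoring/FreeFieldHeatBath.lean` treats the RANDOM scan (diagonalised by plane waves).  The
engine's local sweeps (`latflow.core` Metropolis / heat-bath `sweep`) visit sites in a FIXED
ORDER; for the free field (`λ = 0`, `S = Σ φJφ`, precision matrix `A = J + Jᵀ`) that sweep is
the subject here.

## What is proved

* `sweepUpTo J η φ k` / `orderedSweep J η φ` — the ordered sweep over `Fin (n+1)` with innovations
  `η`: site `k` is set to `hbMean J (current) k + η_k` (heat bath: `η_k ∼ N(0, 1/(2J_{kk}))`
  independent; `η = 0`: the deterministic sweep); bookkeeping `sweepUpTo_apply_of_le` (unvisited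
  sites keep their values), `sweepUpTo_apply_of_lt` (visited sites are never touched again),
  `sweepUpTo_succ_self`; `sum_split_at` (trichotomy split of a `Fin (n+1)` sum).
* **`orderedSweep_gaussSeidel`** — for every site `i` (`J_{ii} ≠ 0`), with `φ' = orderedSweep J η φ`:
  `2J_{ii} φ'_i + Σ_{j<i} (J_{ij}+J_{ji}) φ'_j + Σ_{j>i} (J_{ij}+J_{ji}) φ_j = 2J_{ii} η_i`, i.e.
  `(D + L) φ' = −U φ + D η` for `A = L + D + U` (strictly lower / diagonal / strictly upper):
  the heat-bath sweep IS the Gauss–Seidel splitting `M = D + L`, `φ' = φ + M⁻¹(Dη − Aφ)`, with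
  noise; `orderedSweep_gaussSeidel_zero` — `η = 0` is one Gauss–Seidel sweep for `Aφ = 0`.
* **`splitting_cov_fixedPoint`** — for a symmetric invertible `A` and ANY invertible splitting
  matrix `M`: `(1 − M⁻¹A) A⁻¹ (1 − M⁻¹A)ᵀ + M⁻¹(M + Mᵀ − A)(M⁻¹)ᵀ = A⁻¹`.  This is the covariance
  propagation `Σ ↦ GΣGᵀ + M⁻¹ C M⁻ᵀ` (`G = 1 − M⁻¹A`, noise covariance `C = M + Mᵀ − A`
  independent of `θ`) evaluated at `Σ = A⁻¹`: the target covariance is a FIXED POINT — together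
  with `splitting_mean_fixedPoint` (`Aμ = f` ⇒ the mean map fixes `μ`) the two moments that
  determine a Gaussian are preserved, for EVERY splitting (Gauss–Seidel = ordered heat bath, SOR =
  Adler's over-relaxation, symmetric sweeps, block versions);
  `gaussSeidel_noise` — `M = D + L` has `M + Mᵀ − A = D` (the heat bath's independent site
  innovations pushed through `D`: `Cov(Dη) = D·D⁻¹·D = D` with `Var η_i = 1/A_{ii} = 1/(2J_{ii})`);
  `sor_noise` — `M = ω⁻¹D + L` has `M + Mᵀ − A = (2ω⁻¹ − 1)D`, positive semidefinite exactly for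
  `0 < ω ≤ 2` (the admissible over-relaxation range).

NOT CLAIMED: the probabilistic reading itself (that an affine image of a Gaussian vector plus
independent Gaussian noise is Gaussian with the propagated mean and covariance is standard and not
re-proved; the measure-level invariance for the one-site heat bath on `ℝ^Λ` is
`Exactness/FreeFieldHeatBathExact.lean`); the SPECTRUM of the Gauss–Seidel error operator
`(D + L)⁻¹U` on the lattice Laplacian (Young's `ρ_GS = ρ_J²` for consistently ordered matrices,
Adler–Neuberger's `z = 1` at tuned `ω`) — the ordered sweep is not diagonalised by plane waves and
its autocorrelations are not derived here; `λ > 0`.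
-/

namespace Summit.Ventures.LatticeQCDFlow.Scoring

open Finset Matrix

/-! ## The ordered sweep -/

section Sweep

variable {n : ℕ}

/-- The ORDERED (lexicographic) heat-bath sweep with innovations `η`, after the first `k` sites:
site `k` is set to its conditional mean given the CURRENT configuration, plus `η_k`
(for the heat bath `η_k ∼ N(0, 1/(2J_{kk}))` independent; `η = 0` is the deterministic
Gauss–Seidel sweep). -/
noncomputable def sweepUpTo (J : Fin (n + 1) → Fin (n + 1) → ℝ) (η φ : Fin (n + 1) → ℝ) :
    ℕ → (Fin (n + 1) → ℝ)
  | 0 => φ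
  | k + 1 =>
      if h : k < n + 1 then
        Function.update (sweepUpTo J η φ k) ⟨k, h⟩
          (hbMean J (sweepUpTo J η φ k) ⟨k, h⟩ + η ⟨k, h⟩)
      else sweepUpTo J η φ k

/-- The full ordered sweep `φ ↦ φ'` (all `n + 1` sites, in increasing order). -/
noncomputable def orderedSweep (J : Fin (n + 1) → Fin (n + 1) → ℝ) (η φ : Fin (n + 1) → ℝ) :
    Fin (n + 1) → ℝ :=
  sweepUpTo J η φ (n + 1)

/-- Sites not yet visited carry their original values. -/
theorem sweepUpTo_apply_of_le (J : Fin (n + 1) → Fin (n + 1) → ℝ) (η φ : Fin (n + 1) → ℝ) :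
    ∀ (k : ℕ) (j : Fin (n + 1)), k ≤ j.val → sweepUpTo J η φ k j = φ j := by
  intro k
  induction k with
  | zero => intro j _; rfl
  | succ k ih =>
      intro j hkj
      simp only [sweepUpTo]
      split_ifs with h
      · have hne : j ≠ ⟨k, h⟩ := by
          intro hj
          rw [hj] at hkj
          simp at hkj
        rw [Function.update_of_ne hne]
        exact ih j (by omega)
      · exact ih j (by omega)

/-- A visited site is never touched again: its value is the one set at its own step. -/
theorem sweepUpTo_apply_of_lt (J : Fin (n + 1) → Fin (n + 1) → ℝ) (η φ : Fin (n + 1) → ℝ) :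
    ∀ (k : ℕ) (i : Fin (n + 1)), i.val < k →
      sweepUpTo J η φ k i = sweepUpTo J η φ (i.val + 1) i := by
  intro k
  induction k with
  | zero => intro i hi; omega
  | succ k ih =>
      intro i hik
      by_cases h : k < n + 1
      · by_cases hlt : i.val < k
        · have hne : i ≠ ⟨k, h⟩ := by
            intro hi
            rw [hi] at hlt
            simp at hlt
          have e : sweepUpTo J η φ (k + 1) i = sweepUpTo J η φ k i := by
            simp only [sweepUpTo, dif_pos h]
            rw [Function.update_of_ne hne]
          rw [e]
          exact ih i hlt
        · have hk : i.val = k := by omega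
          rw [hk]
      · have hi := i.isLt
        have e : sweepUpTo J η φ (k + 1) i = sweepUpTo J η φ k i := by
          simp only [sweepUpTo, dif_neg h]
        rw [e]
        exact ih i (by omega)

/-- The value set at site `i`'s own step: conditional mean of the current configuration plus the
innovation. -/
theorem sweepUpTo_succ_self (J : Fin (n + 1) → Fin (n + 1) → ℝ) (η φ : Fin (n + 1) → ℝ)
    (i : Fin (n + 1)) :
    sweepUpTo J η φ (i.val + 1) i = hbMean J (sweepUpTo J η φ i.val) i + η i := by
  have h : i.val < n + 1 := i.isLt
  have hi : (⟨i.val, h⟩ : Fin (n + 1)) = i := Fin.eta i h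
  simp only [sweepUpTo, dif_pos h, hi, Function.update_self]

/-- Trichotomy split of a sum over `Fin (n+1)` at `i`. -/
theorem sum_split_at (g : Fin (n + 1) → ℝ) (i : Fin (n + 1)) :
    ∑ y, g y = (∑ y ∈ univ.filter (fun y => y < i), g y) + g i
      + ∑ y ∈ univ.filter (fun y => i < y), g y := by
  rw [Finset.sum_filter, Finset.sum_filter]
  have h : ∀ y, g y = (if y < i then g y else 0) + (if y = i then g y else 0)
      + (if i < y then g y else 0) := by
    intro y
    rcases lt_trichotomy y i with hy | hy | hy
    · rw [if_pos hy, if_neg hy.ne, if_neg (not_lt.mpr hy.le)]; ring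
    · subst hy; simp
    · rw [if_neg (not_lt.mpr hy.le), if_neg hy.ne', if_pos hy]; ring
  rw [Finset.sum_congr rfl fun y _ => h y, Finset.sum_add_distrib, Finset.sum_add_distrib,
    Finset.sum_ite_eq' univ i g, if_pos (mem_univ i)]

/-- **THE ORDERED HEAT-BATH SWEEP IS GAUSS–SEIDEL WITH NOISE.**  Let `φ' = orderedSweep J η φ`
(sites visited in increasing order, each set to its conditional mean under `e^{−ΣφJφ}` given the
CURRENT configuration, plus `η_i`).  Then for every site `i` with `J_{ii} ≠ 0`:
`2J_{ii} φ'_i + Σ_{j<i} (J_{ij}+J_{ji}) φ'_j + Σ_{j>i} (J_{ij}+J_{ji}) φ_j = 2J_{ii} η_i`,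
i.e. with the precision matrix `A = J + Jᵀ = L + D + U` (strictly lower / diagonal / strictly
upper parts): `(D + L) φ' = −U φ + D η` — the matrix splitting `A = M − N`, `M = D + L`,
`φ' = φ + M⁻¹(Dη − Aφ)`; `η = 0` is one deterministic Gauss–Seidel sweep for `Aφ = 0`. -/
theorem orderedSweep_gaussSeidel (J : Fin (n + 1) → Fin (n + 1) → ℝ) (η φ : Fin (n + 1) → ℝ)
    (i : Fin (n + 1)) (hJ : J i i ≠ 0) :
    2 * J i i * orderedSweep J η φ i
        + (∑ j ∈ univ.filter (fun j => j < i), (J i j + J j i) * orderedSweep J η φ j)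
        + (∑ j ∈ univ.filter (fun j => i < j), (J i j + J j i) * φ j)
      = 2 * J i i * η i := by
  set c := sweepUpTo J η φ i.val with hc
  -- the value at `i`
  have hval : orderedSweep J η φ i = hbMean J c i + η i := by
    unfold orderedSweep
    rw [sweepUpTo_apply_of_lt J η φ (n + 1) i i.isLt, sweepUpTo_succ_self]
  -- the current configuration at step `i`: new values below, old values above
  have hbelow : ∀ j : Fin (n + 1), j < i → c j = orderedSweep J η φ j := by
    intro j hj
    unfold orderedSweep
    rw [hc, sweepUpTo_apply_of_lt J η φ i.val j (Fin.lt_def.mp hj),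
      sweepUpTo_apply_of_lt J η φ (n + 1) j j.isLt]
  have habove : ∀ j : Fin (n + 1), i < j → c j = φ j := by
    intro j hj
    rw [hc, sweepUpTo_apply_of_le J η φ i.val j (le_of_lt (Fin.lt_def.mp hj))]
  -- expand the conditional mean and split the sum at `i`
  rw [hval, hbMean_eq J c i hJ]
  have hsplit := sum_split_at (fun y => (J i y + J y i) * Function.update c i 0 y) i
  simp only [Function.update_self, mul_zero, add_zero] at hsplit
  have hb : ∑ y ∈ univ.filter (fun y => y < i), (J i y + J y i) * Function.update c i 0 y
      = ∑ j ∈ univ.filter (fun j => j < i), (J i j + J j i) * orderedSweep J η φ j := by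
    refine Finset.sum_congr rfl fun y hy => ?_
    have hy' : y < i := (Finset.mem_filter.mp hy).2
    rw [Function.update_of_ne hy'.ne, hbelow y hy']
  have ha : ∑ y ∈ univ.filter (fun y => i < y), (J i y + J y i) * Function.update c i 0 y
      = ∑ j ∈ univ.filter (fun j => i < j), (J i j + J j i) * φ j := by
    refine Finset.sum_congr rfl fun y hy => ?_
    have hy' : i < y := (Finset.mem_filter.mp hy).2
    rw [Function.update_of_ne hy'.ne', habove y hy']
  rw [hsplit, hb, ha]
  field_simp
  ring

/-- **In particular the deterministic sweep (`η = 0`) is the Gauss–Seidel iteration** for the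
linear system `Aφ = 0`: `(D + L)φ' + Uφ = 0` componentwise. -/
theorem orderedSweep_gaussSeidel_zero (J : Fin (n + 1) → Fin (n + 1) → ℝ) (φ : Fin (n + 1) → ℝ)
    (i : Fin (n + 1)) (hJ : J i i ≠ 0) :
    2 * J i i * orderedSweep J 0 φ i
        + (∑ j ∈ univ.filter (fun j => j < i), (J i j + J j i) * orderedSweep J 0 φ j)
        + (∑ j ∈ univ.filter (fun j => i < j), (J i j + J j i) * φ j) = 0 := by
  have h := orderedSweep_gaussSeidel J 0 φ i hJ
  simpa using h

end Sweep

/-! ## Every matrix-splitting sampler fixes the Gaussian law `N(A⁻¹f, A⁻¹)` -/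

section Splitting

variable {ι : Type*} [Fintype ι] [DecidableEq ι]

/-- **Mean fixed point.**  The affine map `θ ↦ θ + M⁻¹(f − Aθ)` (the mean of the random smoother
`θ' = θ + M⁻¹(f + ξ − Aθ)`, `Eξ = 0`) fixes `μ` iff `M⁻¹(Aμ − f) = 0`; in particular `Aμ = f`
suffices, for EVERY splitting matrix `M`. -/
theorem splitting_mean_fixedPoint (A M : Matrix ι ι ℝ) (f μ : ι → ℝ) (hμ : A.mulVec μ = f) :
    μ + M⁻¹.mulVec (f - A.mulVec μ) = μ := by
  rw [hμ, sub_self, Matrix.mulVec_zero, add_zero]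

/-- **Covariance fixed point** (the exactness of matrix-splitting samplers at the level that
determines a Gaussian).  For a symmetric invertible precision matrix `A` and ANY invertible
splitting matrix `M`, the covariance propagation of `θ' = (1 − M⁻¹A)θ + M⁻¹ξ`,
`Cov ξ = M + Mᵀ − A` (independent of `θ`), fixes `A⁻¹`:
`(1 − M⁻¹A) A⁻¹ (1 − M⁻¹A)ᵀ + M⁻¹ (M + Mᵀ − A) (M⁻¹)ᵀ = A⁻¹`.
Gauss–Seidel / the ordered heat bath: `M = D + L`, `M + Mᵀ − A = D` (`gaussSeidel_noise`);
SOR / Adler's over-relaxation: `M = ω⁻¹D + L`, `M + Mᵀ − A = (2 − ω)ω⁻¹ D`. -/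
theorem splitting_cov_fixedPoint (A M : Matrix ι ι ℝ) (hA : A.IsSymm) (hAi : IsUnit A.det)
    (hMi : IsUnit M.det) :
    (1 - M⁻¹ * A) * A⁻¹ * (1 - M⁻¹ * A)ᵀ + M⁻¹ * (M + Mᵀ - A) * (M⁻¹)ᵀ = A⁻¹ := by
  set B := M⁻¹ with hB
  have hAinv : A * A⁻¹ = 1 := Matrix.mul_nonsing_inv A hAi
  have hAinv' : A⁻¹ * A = 1 := Matrix.nonsing_inv_mul A hAi
  have hMinv : B * M = 1 := Matrix.nonsing_inv_mul M hMi
  have hAT : Aᵀ = A := hA.eq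
  have hMTinv : Mᵀ * Bᵀ = 1 := by
    rw [← Matrix.transpose_mul, hMinv, Matrix.transpose_one]
  have h1 : (1 - B * A) * A⁻¹ = A⁻¹ - B := by
    rw [Matrix.sub_mul, Matrix.one_mul, Matrix.mul_assoc, hAinv, Matrix.mul_one]
  have h2 : (1 - B * A)ᵀ = 1 - A * Bᵀ := by
    rw [Matrix.transpose_sub, Matrix.transpose_one, Matrix.transpose_mul, hAT]
  have h3 : (A⁻¹ - B) * (1 - A * Bᵀ) = A⁻¹ - Bᵀ - B + B * (A * Bᵀ) := by
    rw [Matrix.sub_mul, Matrix.mul_sub, Matrix.mul_sub, Matrix.mul_one, Matrix.mul_one,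
      ← Matrix.mul_assoc A⁻¹ A Bᵀ, hAinv', Matrix.one_mul]
    abel
  have h4 : B * (M + Mᵀ - A) * Bᵀ = Bᵀ + B - B * (A * Bᵀ) := by
    rw [Matrix.mul_sub, Matrix.mul_add, hMinv, Matrix.sub_mul, Matrix.add_mul, Matrix.one_mul,
      Matrix.mul_assoc B Mᵀ Bᵀ, hMTinv, Matrix.mul_one, Matrix.mul_assoc]
  rw [h1, h2, h3, h4]
  abel

omit [Fintype ι] [DecidableEq ι] in
/-- The Gauss–Seidel splitting of a matrix `A = L + D + Lᵀ` with `D` symmetric (e.g. diagonal):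
`M = D + L` has noise covariance `M + Mᵀ − A = D` — independent site innovations of variance
`D_{ii}⁻¹·D_{ii}·... = 1/A_{ii}` pushed through `D`, exactly the heat bath's `η_i ∼ N(0, 1/(2J_{ii}))`
of `orderedSweep_gaussSeidel` (`A_{ii} = 2J_{ii}`). -/
theorem gaussSeidel_noise (D L : Matrix ι ι ℝ) (hD : D.IsSymm) :
    (D + L) + (D + L)ᵀ - (L + D + Lᵀ) = D := by
  rw [Matrix.transpose_add, hD.eq]
  abel

omit [Fintype ι] [DecidableEq ι] in
/-- The SOR / over-relaxed splitting `M = ω⁻¹ D + L` (`ω ≠ 0`) has noise covariance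
`M + Mᵀ − A = (2ω⁻¹ − 1) D = ((2 − ω)/ω) D` — positive semidefinite exactly for `0 < ω ≤ 2` when
`D ≽ 0`: the admissible range of Adler's over-relaxation parameter. -/
theorem sor_noise (D L : Matrix ι ι ℝ) (hD : D.IsSymm) (ω : ℝ) :
    (ω⁻¹ • D + L) + (ω⁻¹ • D + L)ᵀ - (L + D + Lᵀ) = (2 * ω⁻¹ - 1) • D := by
  rw [Matrix.transpose_add, Matrix.transpose_smul, hD.eq, sub_smul, mul_smul, two_smul, one_smul]
  abel

end Splitting

end Summit.Ventures.LatticeQCDFlow.Scoring
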